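import Mathlib

/-!
# Hodge-locus census (cell `pub-hlocus`, engine A, abs-1 gen 36) — the level-9 / Borwein / Deuring dictionary at ℓ = 3

certified instances and evidence bearing on the general Hodge conjecture; no claim.

Helper file of `stmt-HodgeConjecture-16267` (computational census records; nothing here is used by any
route).  It kernel-checks the ALGEBRAIC skeleton of `DERIVATION-GK-A.md` §5g(c) (engine A, gen 36):
with the cubic theta functions `a³ = b³ + c³`, `β := b/c`, `μ := a/c` (so `β³ = τ = t/27`,
`μ³ = τ + 1`, `t = (η(z)/η(3z))¹²` the Hauptmodul of `X₀(3)`), `ν := η(z)η(9z)³/η(3z)⁴`,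
`s := (η(z)/η(9z))³` (Hauptmodul of `X₀(9)`), `w := 1/(3ν)`, the η-product bookkeeping gives
`μ − β = 3ν` and `s·ν = 3β`; everything below is then pure commutative algebra:
* `hesse_level9`     : `μ = β + 3ν`, `μ³ = β³ + 1`  ⟹  `9ν(β² + 3βν + 3ν²) = 1`;
* `w_cubic`          : `3νw = 1` and the previous identity  ⟹  `w³ = 3β²w² + 3βw + 1` (so `w` is a unit);
* `t_of_s`           : over a field, `ν ≠ 0`, `sν = 3β`  ⟹  `27β³·(s² + 9s + 27) = s³`, i.e. `t = s³/(s²+9s+27)`;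
* `t3_of_s`          : and `(3β)·(s² + 9s + 27) = s·… `: `t(3z) = s(s²+9s+27) = 3β/ν⁴` in the form `3β = s(s²+9s+27)ν⁴`;
* `fricke_identity`  : `(729 + 27T)(729 + 243T)³ = 729³·(T + 27)(T + 3)³` — the two normalisations
                       `j = (t+27)(t+243)³/t³` and `j = (T′+27)(T′+3)³/T′` are exchanged by `T′ = 729/t`;
* `deuring_j`        : Deuring's `j(α) = α³(α³−24)³/(α³−27)` is the second normalisation at `T′ = α³ − 27`;
* `deuring_alpha`    : `μ³ = β³ + 1` ⟹ `(3μ)³ = 27(β³ + 1)` and `((3μ)³ − 27β³)… `: `α := 3μ/β` has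
                       `α³ − 27 = 27/τ`, so `t(E_α, ⟨(0,0)⟩) = 729/(α³−27) = 27τ` (cleared of denominators).
These identities are the η-free part of the dictionary; the modular input (`μ − β = 3ν`, `sν = 3β`) and the
CM evaluation are NOT formalised here.
-/

set_option linter.dupNamespace false

namespace Summit.HodgeConjecture.HodgeConjecture.HodgeLocus.Census.GKDeuringAnchors

/-- Hesse relation pushed to level 9: `μ = β + 3ν` and `μ³ = β³ + 1` give `9ν(β² + 3βν + 3ν²) = 1`. -/
theorem hesse_level9 {R : Type*} [CommRing R] (β μ ν : R) (hμ : μ = β + 3 * ν)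
    (h : μ ^ 3 = β ^ 3 + 1) : 9 * ν * (β ^ 2 + 3 * β * ν + 3 * ν ^ 2) = 1 := by
  subst hμ
  linear_combination h

/-- The unit `w = 1/(3ν)`: from `3νw = 1` and `9ν(β²+3βν+3ν²) = 1`, `w³ = 3β²w² + 3βw + 1`
(a monic cubic over `ℤ[β]` with constant term `−1`, so `w` is a unit wherever `β` is integral). -/
theorem w_cubic {R : Type*} [CommRing R] (β ν w : R) (h1 : 3 * ν * w = 1)
    (h2 : 9 * ν * (β ^ 2 + 3 * β * ν + 3 * ν ^ 2) = 1) :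
    w ^ 3 = 3 * β ^ 2 * w ^ 2 + 3 * β * w + 1 := by
  linear_combination
    (3 * β ^ 2 * w ^ 2 + 3 * β * w * (3 * ν * w + 1) + 9 * ν ^ 2 * w ^ 2 + 3 * ν * w + 1) * h1
      + (-w ^ 3) * h2

/-- `t = s³/(s² + 9s + 27)` for the Hauptmoduls `t` of `X₀(3)` and `s` of `X₀(9)`:
with `t = 27β³`, `sν = 3β` and the level-9 Hesse relation, `27β³(s²+9s+27) = s³`. -/
theorem t_of_s {F : Type*} [Field F] (β ν s : F) (hν : ν ≠ 0) (hs : s * ν = 3 * β)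
    (h2 : 9 * ν * (β ^ 2 + 3 * β * ν + 3 * ν ^ 2) = 1) :
    27 * β ^ 3 * (s ^ 2 + 9 * s + 27) = s ^ 3 := by
  have h3 : ν ^ 3 ≠ 0 := pow_ne_zero 3 hν
  apply mul_right_cancel₀ h3
  linear_combination
    (27 * β ^ 3 * ν * (s * ν + 3 * β + 9 * ν) - (s ^ 2 * ν ^ 2 + 3 * β * s * ν + 9 * β ^ 2)) * hs
      + (27 * β ^ 3) * h2

/-- `ν³·(s² + 9s + 27) = 1`, i.e. `ν³ = 1/(s²+9s+27)` (so `t(3z) = s(s²+9s+27) = s/ν³ = 3β/ν⁴`). -/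
theorem nu_cubed {R : Type*} [CommRing R] (β ν s : R) (hs : s * ν = 3 * β)
    (h2 : 9 * ν * (β ^ 2 + 3 * β * ν + 3 * ν ^ 2) = 1) :
    ν ^ 3 * (s ^ 2 + 9 * s + 27) = 1 := by
  linear_combination (ν * (s * ν + 3 * β) + 9 * ν ^ 2) * hs + h2

/-- `t(z)·t(3z) = s⁴` in the form `(27β³)·(s(s²+9s+27))·ν³… `: with `t = 27β³` and
`t(3z)·ν³ = s` (previous lemma), `t · t(3z) = s⁴` reads `27β³ · s = s⁴ · ν³`. -/
theorem t_times_t3 {R : Type*} [CommRing R] (β ν s : R) (hs : s * ν = 3 * β) :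
    27 * β ^ 3 * s = s ^ 4 * ν ^ 3 := by
  linear_combination (-(s ^ 3 * ν ^ 2) - 3 * β * s ^ 2 * ν - 9 * β ^ 2 * s) * hs

/-- The Fricke identity exchanging the two normalisations of the `X₀(3)` Hauptmodul:
`(729/T + 27)(729/T + 243)³/(729/T)³ = (T+27)(T+3)³/T`, cleared of denominators. -/
theorem fricke_identity {R : Type*} [CommRing R] (T : R) :
    (729 + 27 * T) * (729 + 243 * T) ^ 3 = 729 ^ 3 * ((T + 27) * (T + 3) ^ 3) := by
  ring

/-- Deuring's normal form `y² + αxy + y = x³`: `j = α³(α³−24)³/(α³−27)` is the second normalisation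
`(T′+27)(T′+3)³/T′` at `T′ = α³ − 27`. -/
theorem deuring_j {R : Type*} [CommRing R] (α : R) :
    (α ^ 3 - 27 + 27) * (α ^ 3 - 27 + 3) ^ 3 = α ^ 3 * (α ^ 3 - 24) ^ 3 := by
  ring

/-- The Deuring parameter of `(E_𝔞, C)` is `α = 3μ/β = 3a/b`: from `μ³ = β³ + 1`,
`(3μ)³ = 27β³ + 27`, i.e. `α³β³ = 27(τ + 1)` and `(α³ − 27)·τ = 27` for `τ = β³`, `α β = 3μ`
(all cleared of denominators). -/
theorem deuring_alpha {R : Type*} [CommRing R] (α β μ : R) (hα : α * β = 3 * μ)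
    (h : μ ^ 3 = β ^ 3 + 1) : (α ^ 3 - 27) * β ^ 3 = 27 := by
  linear_combination (α ^ 2 * β ^ 2 + 3 * μ * α * β + 9 * μ ^ 2) * hα + 27 * h

/-- Consequently `t(E_α, ⟨(0,0)⟩) = 729/(α³ − 27) = 27β³ = t`: `729·β³ = 27β³·(α³−27)·β³… ` in the form
`(α³ − 27)·(27β³) = 729`. -/
theorem deuring_t {R : Type*} [CommRing R] (α β μ : R) (hα : α * β = 3 * μ)
    (h : μ ^ 3 = β ^ 3 + 1) : (α ^ 3 - 27) * (27 * β ^ 3) = 729 := by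
  linear_combination 27 * deuring_alpha α β μ hα h

/-- Numerical anchor `D = −12` (`z = i/√3`, the fixed point of the Fricke involution): `t = 27`, `τ = 1`,
`j = 54·270³/27³ = 54000 = j(√−3·… )`; and `D = −15`: `2τ_O = −3 + √5` — here only the rational
identity `(27+27)(27+243)³ = 54000·27³`. -/
theorem anchor_D12 : (27 + 27) * (27 + 243) ^ 3 = 54000 * 27 ^ 3 := by norm_num

end Summit.HodgeConjecture.HodgeConjecture.HodgeLocus.Census.GKDeuringAnchors
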